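import Literature.Computability.Complexity.CHCounting
import Literature.Computability.Complexity.StringEquality
import HarnessLib

/-!
# The bits of a `#P` function are in the counting hierarchy (proof file; trunk CplxCore)

Sibling proof file of `CountingHierarchy.lean` (D-0014): the named fact `sharpP_bits_mem_CH` —
for `g ∈ #P` the bit language `{⟨x, bin j⟩ | bit j of g x is 1}` is in `CH` — is PROVED here
(`sharpP_bits_mem_CH_holds`).

Source. Bürgisser (ECCC TR06-113, §2.1, p. 5) recalls `#P` as the functions
`g x = |{y ∈ {0,1}^{p(|x|)} | ⟨x, y⟩ ∈ B}|` with `B ∈ P` and notes "Hence functions in `#P` can be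
evaluated in polynomial time by oracle calls to `PP`"; with Torán's `Cₖ₊₁P = PP^{CₖP}` ((3) loc.
cit.) the bit language lies in `P^{PP} ⊆ C₂P ⊆ CH`. In the tree's operator form of `CH`
(`Cₖ₊₁P = C'·CₖP`) this evaluation is already available as the toolkit theorem
`cnt_testBit_mem_CH` (`CHCounting.lean`): for `V ∈ CH` (here `V = B ∈ P ⊆ CH`) the language
`{z | bit (val (sndP z)) of #{y ∈ {0,1}^{r |fstP z|} | ⟨fstP z, y⟩ ∈ V} is 1}` is in `CH`, read
through the total projections `fstP`/`sndP`. The named fact speaks about the strings that are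
*literally* of the form `⟨x, bin j⟩ = boolPair x (encodeNat j)`, so it remains to intersect with two
polynomial-time tests (`inter_P_mem_CH`):

* `setOf_pair_eq_mem_P` — the well-formed pairs `{z | ⟨fstP z, sndP z⟩ = z}` are in `P`
  (an equality test of two `FP` maps, `setOf_apply_eq_apply_mem_P` of `StringEquality.lean`);
* `setOf_norm_sndP_eq_mem_P` — "the second component is a canonical numeral",
  `{z | norm (sndP z) = sndP z}` (`norm w = bin (val w)`, `norm_eq_encodeNat`), is in `P` likewise.

No new definitions, no new named facts (D-0026): net debt delta −1.

## References

* P. Bürgisser, *On defining integers in the counting hierarchy and proving lower bounds in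
  algebraic complexity*, ECCC TR06-113 (2006), §2.1 (p. 5: `#P`, "evaluated in polynomial time by
  oracle calls to `PP`", (3) `Cₖ₊₁P = PP^{CₖP}`); journal version Comput. Complexity 18 (2009) 81–103.
* J. Torán, *Complexity classes defined by counting quantifiers*, J. ACM 38 (1991) 753–774, §4.
* S. Arora, B. Barak, *Computational Complexity: A Modern Approach*, CUP 2009, §0.1, §1.3.
-/

namespace Literature.Computability.Complexity

open _root_.Computability Polynomial PRelSigma TTClosure Brick PPSharpP ThresholdPP

/-! ### Two polynomial-time side conditions -/

/-- **Well-formed pairs are recognisable in `P`**: `{z | ⟨fstP z, sndP z⟩ = z} ∈ P` (compare the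
re-paired projections with the input; Arora–Barak 2009, §0.1/§1.3: pairing and "basic" string
manipulation are polynomial time). [cite: AroraBarak2009, §1.3] -/
theorem setOf_pair_eq_mem_P : ({z | boolPair (fstP z) (sndP z) = z} : Language Bool) ∈ Classes.P := by
  have hid : (id : List Bool → List Bool) ∈ FP := PolyTimeComputable.id _
  refine mem_P_of_iff (setOf_apply_eq_apply_mem_P (pairFn_mem_FP fstP_mem_FP sndP_mem_FP) hid) _
    fun z => ?_
  change boolPair (fstP z) (sndP z) = z ↔ pairFn fstP sndP z = id z
  rw [pairFn_apply, id_eq]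

/-- **Canonical second component is recognisable in `P`**: `{z | norm (sndP z) = sndP z} ∈ P`, where
`norm w = bin (val w)` strips the redundant most significant zeros, so that `norm (sndP z) = sndP z`
says `sndP z = bin j` for some `j` (Arora–Barak 2009, §0.1: binary representation). [cite: AroraBarak2009, §1.3] -/
theorem setOf_norm_sndP_eq_mem_P : ({z | norm (sndP z) = sndP z} : Language Bool) ∈ Classes.P :=
  setOf_apply_eq_apply_mem_P (comp_mem_FP norm_mem_FP sndP_mem_FP) sndP_mem_FP

/-! ### Discharge of `sharpP_bits_mem_CH` -/

/-- **`#P` functions can be evaluated bitwise in `CH`** (discharge of the named fact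
`sharpP_bits_mem_CH`): for `g ∈ #P`, `{⟨x, bin j⟩ | bit j of g x is 1} ∈ CH`. With
`g x = #{y ∈ {0,1}^{p|x|} | ⟨x, y⟩ ∈ R}`, `R ∈ P ⊆ CH`, the language is the intersection of the two
`P` side conditions above with the bit language of the count (`cnt_testBit_mem_CH`), since on
`z = ⟨x, bin j⟩` one has `fstP z = x`, `val (sndP z) = j`, and conversely a well-formed `z` with
canonical second component is `⟨fstP z, bin (val (sndP z))⟩` (Bürgisser, ECCC TR06-113, §2.1,
p. 5: "functions in `#P` can be evaluated in polynomial time by oracle calls to `PP`", with (3)). [cite: Burgisser2006, §2.1] -/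
theorem sharpP_bits_mem_CH_holds : sharpP_bits_mem_CH := by
  intro g hg
  obtain ⟨R, hR, p, hgR⟩ := hg
  have hT := cnt_testBit_mem_CH p (P_subset_CH hR)
  refine mem_CH_of_iff (inter_P_mem_CH setOf_pair_eq_mem_P (inter_P_mem_CH setOf_norm_sndP_eq_mem_P hT))
    _ fun z => ?_
  rw [memL_inf', memL_inf']
  change (∃ x j, z = boolPair x (encodeNat j) ∧ (g x).testBit j = true) ↔
    boolPair (fstP z) (sndP z) = z ∧ norm (sndP z) = sndP z ∧
      (cnt (p.eval (fstP z).length) {y | boolPair (fstP z) y ∈ R}).testBit (bitsToNat (sndP z)) = true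
  constructor
  · rintro ⟨x, j, rfl, hbit⟩
    rw [fstP_boolPair, sndP_boolPair, norm_encodeNat, bitsToNat_encodeNat, ← countWitnesses_eq_cnt,
      ← hgR]
    exact ⟨rfl, rfl, hbit⟩
  · rintro ⟨hz, hcanon, hbit⟩
    refine ⟨fstP z, bitsToNat (sndP z), ?_, ?_⟩
    · rw [← norm_eq_encodeNat, hcanon]
      exact hz.symm
    · rw [hgR, countWitnesses_eq_cnt]
      exact hbit

end Literature.Computability.Complexity
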